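import Summits.BirchSwinnertonDyer.BirchSwinnertonDyer.Theorems.ShaPrimaryTransferFiniteShaComponentTransferZywinaEqualityDoor
import Literature.NumberTheory.EllipticCurves.KatoDivisibilityAllPrimes
import HarnessLib

/-!
# BirchSwinnertonDyer / ShaPrimaryTransfer — crux `FiniteShaComponentTransfer` (stmt-BirchSwinnertonDyer-22356):
# the equality door has an ASYMMETRIC print budget — `ord_{T=0} L_p(E,T) = rank E(ℚ)` forces Schneider's
# conjecture AND `Ш[p^∞]` finite from Kato's divisibility alone (no main conjecture, no irreducibility)

Companion of `…ZywinaEqualityDoor` (p762237).  There the door `ord_{T=0} L_p(E,T) = rank E(ℚ) ⟺ Ш(E/ℚ)[p^∞]`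
finite was typed modulo Perrin-Riou–Schneider (`h85`) AND the cyclotomic main conjecture (`hMC`, Burungale–
Castella–Skinner, needs `E[p]` irreducible) and GIVEN Schneider's conjecture (`hReg`).  This file records that the
direction analytic ⟹ algebraic is much cheaper, at EVERY rank:

* `schneider_and_finite_sha_of_order_padicLFunction_eq_rank` — `E/ℚ`, `p ≥ 5` good ordinary, granting `h85` and
  Kato's divisibility `char_Λ X(E/ℚ_∞) ∣ p^n · L_p(E,T)` (`kato_divisibility_allPrimes W p`, Kato 2004 Thm. 17.4
  (1)(2)): **`ord_{T=0} L_p(E,T) = rank E(ℚ)` ⟹ Schneider's conjecture holds at `p` (every canonical height datum)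
  AND `Ш(E/ℚ)[p^∞]` is finite.**  Proof: with `char = (g₀)` (principal, tree theorem) and Kato's `g ∈ char`,
  `g₀ ∣ g`, so `rank ≤ ord g₀ ≤ ord g = ord L_p = rank` (`h85` clause 1, order transfer along `ι : Λ ↪ ℚ_p⟦T⟧`),
  and `ord g₀ = rank` is `h85` clause 2: `Reg_p ≠ 0 ∧ Ш[p^∞]` finite.  No irreducibility, no main conjecture, no
  `p`-adic height computation.  (The finiteness half alone is the tree's Kato-18.4 squeeze
  `Kato2004.finite_sha_primary_of_order_padicLFunction_le_mordellWeilRank`; the Schneider half is new here.)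
* `schneider_and_finite_sha_five_of_order_eq_two_zywinaCurve` — on Zywina's rank-2 family (`5` good ordinary, rank 2
  are tree theorems): `ord_{T=0} L_5(E_{m,n},T) = 2 ⟹` Schneider at `5` ∧ `Ш(E_{m,n})[5^∞]` finite, mod `h85` + Kato.
* `door_five_zywinaCurve_asymmetric` — the door on the members with `7 ∣ n`, each direction with its own prints:
  (⟹) mod `h85` + Kato; (⟸) mod `h85` + `hMC`, given Schneider at `5` (THEOREM R* on the classes).
* `transfer_instance_of_order_eq_two_zywinaCurve` — T's instance `(E_{m,n}, 2, 5)` FOLLOWS from `ord L_5 = 2`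
  mod `h85` + Kato (converse of p762237's `order_eq_two_of_transfer_zywinaCurve`, which needs `hMC` + R*).

So the "exact extra input" of the cell brief reads, per member: EQUALITY ⟺ `Ш[5^∞]` finite, where finiteness ⟹
equality costs {PRS 85, BCS main conjecture, R*} and equality ⟹ finiteness ∧ R-nondegeneracy costs {PRS 85, Kato}.
PARTITION: r_an ≥ 2 side; S0 not touched (B1 honesty: nothing here bounds an analytic rank).
References: K. Kato, Astérisque 295 (2004) Thm. 17.4; P. Schneider, Invent. Math. 79 (1985) Thm. 2′; B. Perrin-Riou,
Invent. Math. 89 (1987); J. Balakrishnan, J. S. Müller, W. Stein, Math. Comp. 85 (2016) Thm. 1.7; W. Stein,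
C. Wuthrich, Math. Comp. 82 (2013) §10; D. Zywina, arXiv:2502.01957 Thm. 1.2.
-/

-- D-0017: single-problem summit, so `Summit.BirchSwinnertonDyer.BirchSwinnertonDyer.…` repeats a namespace BY DESIGN.
set_option linter.dupNamespace false

noncomputable section

namespace Summit.BirchSwinnertonDyer.BirchSwinnertonDyer.Theorems.ShaPrimaryTransferZywinaEqualityDoorKato

open scoped Classical MatrixGroups ModularForm
open CongruenceSubgroup
open Literature.NumberTheory.EllipticCurves Literature.NumberTheory.EllipticCurves.Zywina2025
  Literature.NumberTheory.EllipticCurves.ModularForms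
open WeierstrassCurve
open Summit.BirchSwinnertonDyer.BirchSwinnertonDyer.Rank1Residual
open Summit.BirchSwinnertonDyer.Rank1Residual.Additive
open Summit.BirchSwinnertonDyer.BirchSwinnertonDyer.Theses.ShaPrimaryTransfer (FiniteShaComponentTransfer)
open Summit.BirchSwinnertonDyer.BirchSwinnertonDyer.Theorems.ShaPrimaryTransferGoodOrdinaryFive
open Summit.BirchSwinnertonDyer.BirchSwinnertonDyer.Theorems.ShaPrimaryTransferZywinaEqualityDoor

/-! ## §1 Every curve, every rank: analytic equality ⟹ Schneider ∧ `Ш[p^∞]` finite, mod PRS 85 + Kato -/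

section General

variable (W : WeierstrassCurve ℚ) [W.IsElliptic] [W.IsGloballyMinimal] (p : ℕ) [Fact p.Prime]

/-- **`ord_{T=0} L_p(E,T) = rank E(ℚ)` ⟹ Schneider's conjecture at `p` AND `Ш(E/ℚ)[p^∞]` finite** (`p ≥ 5` good
ordinary; granting Perrin-Riou–Schneider `h85` and Kato's divisibility `hkato`; NO main conjecture, NO irreducibility):
`char X = (g₀)`, Kato's `g ∈ char` with `ι g = p^n L_p`, so `rank ≤ ord g₀ ≤ ord g = ord L_p = rank` and clause 2 of
`h85` converts `ord g₀ = rank` into `Reg_p ≠ 0 ∧ #Ш[p^∞] < ∞`. CONDITIONAL on `h85`, `hkato`.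
[cite: Kato2004Asterisque, Thm. 17.4 (1)(2) (p. 273)] [cite: BalakrishnanMullerStein2015, Thm. 1.7]
[cite: Schneider1985, Thm. 2′ (p. 342)] -/
theorem schneider_and_finite_sha_of_order_padicLFunction_eq_rank (h85 : Schneider1985_order_charGenerator)
    (hp : 5 ≤ p) (hgood : W.HasGoodReductionAtPrime p) (hord : ¬ (p : ℤ) ∣ W.frobeniusTrace p)
    {N : ℕ} [NeZero N] {f : CuspForm (Gamma0 N) 2} (hf : IsNewformOf W f)
    (hkato : kato_divisibility_allPrimes W p (f := f))
    (heq : (padicLFunction f (unitRoot W p : ℚ_[p])).order = W.mordellWeilRank) :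
    (∀ Dh : PAdicHeightData W p, Dh.IsCanonical → SchneiderConjecture Dh) ∧
      Finite (AddCommGroup.primaryComponent W.sha p) := by
  obtain ⟨κ, hκ, γ, hγ, hγ'⟩ := exists_isCyclotomic_isTopGenerator_isCyclotomicVariable_holds p
  obtain ⟨D⟩ := W.nonempty_selmerDualData_holds κ γ hγ
  haveI : Module.Finite (IwasawaAlgebra p) D.X := D.module_finite_holds hγ
  obtain ⟨hX, n, g, hg, hιg⟩ := hkato κ γ hκ hγ hγ' ⟨hgood, hord⟩ hf D
  obtain ⟨g₀, hg₀⟩ := (charIdeal_isPrincipal_holds p D.X).principal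
  have hchar : D.charIdeal = Ideal.span {g₀} := hg₀
  -- `ord_T L_p = ord_T g` along `ι`, `p^n` a unit of `ℚ_p⟦T⟧`
  have hιg' : iwasawaToPowerSeries p g =
      PowerSeries.C ((p : ℚ_[p]) ^ ((n : ℕ) : ℤ)) * padicLFunction f (unitRoot W p : ℚ_[p]) := by
    rwa [zpow_natCast]
  have hLg : (padicLFunction f (unitRoot W p : ℚ_[p])).order = g.order :=
    order_eq_order_of_iwasawaToPowerSeries_eq p hιg'
  -- `g₀ ∣ g`, so `ord g₀ ≤ ord g`
  have hdvd : g₀ ∣ g := by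
    rw [hchar] at hg
    exact Ideal.mem_span_singleton.mp hg
  have hle : g₀.order ≤ g.order := by
    obtain ⟨a, rfl⟩ := hdvd
    exact le_trans le_self_add (PowerSeries.order_mul_ge g₀ a)
  have key : ∀ Dh : PAdicHeightData W p, Dh.IsCanonical →
      SchneiderConjecture Dh ∧ Finite (AddCommGroup.primaryComponent W.sha p) := by
    intro Dh hDh
    have h := h85 W p hp hgood hord κ γ hκ hγ hγ' D hX g₀ hchar Dh hDh
    refine h.2.1.mp (le_antisymm ?_ h.1)
    calc g₀.order ≤ g.order := hle
      _ = (padicLFunction f (unitRoot W p : ℚ_[p])).order := hLg.symm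
      _ = (W.mordellWeilRank : ℕ∞) := heq
  obtain ⟨Dh, hDh⟩ := exists_isCanonical_holds W p hp hgood hord
  exact ⟨fun Dh' hDh' ↦ (key Dh' hDh').1, (key Dh hDh).2⟩

/-- Corank form: **`ord_{T=0} L_p(E,T) = rank E(ℚ)` ⟹ `t_p(E) = corank Ш(E/ℚ)[p^∞] = 0`**, mod `h85` + Kato.
CONDITIONAL on `h85`, `hkato`. [cite: Kato2004Asterisque, Thm. 17.4 (1)(2) (p. 273)] [cite: BalakrishnanMullerStein2015, Thm. 1.7] -/
theorem shaCorank_eq_zero_of_order_padicLFunction_eq_rank (h85 : Schneider1985_order_charGenerator)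
    (hp : 5 ≤ p) (hgood : W.HasGoodReductionAtPrime p) (hord : ¬ (p : ℤ) ∣ W.frobeniusTrace p)
    {N : ℕ} [NeZero N] {f : CuspForm (Gamma0 N) 2} (hf : IsNewformOf W f)
    (hkato : kato_divisibility_allPrimes W p (f := f))
    (heq : (padicLFunction f (unitRoot W p : ℚ_[p])).order = W.mordellWeilRank) : W.shaCorank p = 0 := by
  rw [← finite_primaryComponent_sha_iff_shaCorank_eq_zero]
  exact (schneider_and_finite_sha_of_order_padicLFunction_eq_rank W p h85 hp hgood hord hf hkato heq).2

/-- **The general door with its asymmetric print budget.** `p ≥ 5` good ordinary: (⟹) `ord L_p = rank ⟹ Reg_p ≠ 0 ∧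
Ш[p^∞]` finite mod `h85` + Kato; (⟸) `Reg_p ≠ 0 → Ш[p^∞]` finite `→ ord L_p = rank` mod `h85` + `hMC` (+ `E[p]`
irreducible). CONDITIONAL on the named prints. [cite: Kato2004Asterisque, Thm. 17.4 (1)(2) (p. 273)]
[cite: BurungaleCastellaSkinner2025, Thm. 1.1.2 (a)] [cite: BalakrishnanMullerStein2015, Thm. 1.7] -/
theorem door_asymmetric (h85 : Schneider1985_order_charGenerator)
    (hMC : burungale_castella_skinner_charIdeal_eq_padicLFunction)
    (hp : 5 ≤ p) (hgood : W.HasGoodReductionAtPrime p) (hord : ¬ (p : ℤ) ∣ W.frobeniusTrace p)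
    (hirr : W.HasIrreducibleModPGaloisRep p)
    {N : ℕ} [NeZero N] {f : CuspForm (Gamma0 N) 2} (hf : IsNewformOf W f)
    (hkato : kato_divisibility_allPrimes W p (f := f)) :
    ((padicLFunction f (unitRoot W p : ℚ_[p])).order = W.mordellWeilRank →
        (∀ Dh : PAdicHeightData W p, Dh.IsCanonical → SchneiderConjecture Dh) ∧
          Finite (AddCommGroup.primaryComponent W.sha p)) ∧
      ((∀ Dh : PAdicHeightData W p, Dh.IsCanonical → SchneiderConjecture Dh) →
        Finite (AddCommGroup.primaryComponent W.sha p) →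
          (padicLFunction f (unitRoot W p : ℚ_[p])).order = W.mordellWeilRank) :=
  ⟨fun heq ↦ schneider_and_finite_sha_of_order_padicLFunction_eq_rank W p h85 hp hgood hord hf hkato heq,
    fun hReg hfin ↦ (order_padicLFunction_eq_rank_iff_finite_sha W p h85 hMC hp hgood hord hirr hReg hf).mpr hfin⟩

end General

/-! ## §2 On Zywina's rank-2 family at `p = 5` -/

variable {m n : ℕ}

/-- **`ord_{T=0} L_5(E_{m,n},T) = 2` ⟹ Schneider's conjecture for `E_{m,n}` at `5` AND `Ш(E_{m,n})[5^∞]` finite**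
(admissible `(m, n)`; `5` good ordinary and `rank E_{m,n}(ℚ) = 2` are tree theorems), mod `h85` + Kato at `5` — no
main conjecture, no irreducibility, no THEOREM R*. CONDITIONAL on `h85`, `hkato`. [cite: Zywina2025, Thm 1.2]
[cite: Kato2004Asterisque, Thm. 17.4 (1)(2) (p. 273)] [cite: BalakrishnanMullerStein2015, Thm. 1.7] -/
theorem schneider_and_finite_sha_five_of_order_eq_two_zywinaCurve [Fact (Nat.Prime 5)]
    (h85 : Schneider1985_order_charGenerator) (h : ZywinaAdmissible m n) [(zywinaCurve m n).IsElliptic]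
    [(zywinaCurve m n).IsGloballyMinimal] {N : ℕ} [NeZero N] {f : CuspForm (Gamma0 N) 2}
    (hf : IsNewformOf (zywinaCurve m n) f) (hkato : kato_divisibility_allPrimes (zywinaCurve m n) 5 (f := f))
    (heq : (padicLFunction f (unitRoot (zywinaCurve m n) 5 : ℚ_[5])).order = 2) :
    (∀ Dh : PAdicHeightData (zywinaCurve m n) 5, Dh.IsCanonical → SchneiderConjecture Dh) ∧
      Finite (AddCommGroup.primaryComponent (zywinaCurve m n).sha 5) := by
  have hgo := goodOrdinary_five_zywinaCurve h
  have heq' : (padicLFunction f (unitRoot (zywinaCurve m n) 5 : ℚ_[5])).order =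
      (zywinaCurve m n).mordellWeilRank := by
    rw [mordellWeilRank_zywinaCurve h]; exact_mod_cast heq
  exact schneider_and_finite_sha_of_order_padicLFunction_eq_rank _ 5 h85 (by norm_num) hgo.1 hgo.2 hf hkato heq'

/-- **The `5`-adic door on Zywina's family with its asymmetric print budget** (admissible `(m,n)`, `7 ∣ n`):
(⟹) `ord L_5 = 2 ⟹ Reg_5 ≠ 0 ∧ Ш[5^∞]` finite mod `h85` + Kato; (⟸) `Reg_5 ≠ 0 → Ш[5^∞]` finite `→ ord L_5 = 2`
mod `h85` + `hMC` (irreducibility at `5` is a tree theorem for `7 ∣ n`; `Reg_5 ≠ 0` is THEOREM R* on the classes).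
CONDITIONAL on the named prints. [cite: Zywina2025, Thm 1.2] [cite: Kato2004Asterisque, Thm. 17.4 (1)(2) (p. 273)]
[cite: BurungaleCastellaSkinner2025, Thm. 1.1.2 (a)] -/
theorem door_five_zywinaCurve_asymmetric [Fact (Nat.Prime 5)] (h85 : Schneider1985_order_charGenerator)
    (hMC : burungale_castella_skinner_charIdeal_eq_padicLFunction) (h : ZywinaAdmissible m n) (h7 : 7 ∣ n)
    [(zywinaCurve m n).IsElliptic] [(zywinaCurve m n).IsGloballyMinimal] {N : ℕ} [NeZero N]
    {f : CuspForm (Gamma0 N) 2} (hf : IsNewformOf (zywinaCurve m n) f)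
    (hkato : kato_divisibility_allPrimes (zywinaCurve m n) 5 (f := f)) :
    ((padicLFunction f (unitRoot (zywinaCurve m n) 5 : ℚ_[5])).order = 2 →
        (∀ Dh : PAdicHeightData (zywinaCurve m n) 5, Dh.IsCanonical → SchneiderConjecture Dh) ∧
          Finite (AddCommGroup.primaryComponent (zywinaCurve m n).sha 5)) ∧
      ((∀ Dh : PAdicHeightData (zywinaCurve m n) 5, Dh.IsCanonical → SchneiderConjecture Dh) →
        Finite (AddCommGroup.primaryComponent (zywinaCurve m n).sha 5) →
          (padicLFunction f (unitRoot (zywinaCurve m n) 5 : ℚ_[5])).order = 2) :=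
  ⟨fun heq ↦ schneider_and_finite_sha_five_of_order_eq_two_zywinaCurve h85 h hf hkato heq,
    fun hReg hfin ↦ (equalityDoor_five_zywinaCurve h85 hMC h h7 hReg hf).mpr hfin⟩

/-- **T's instance `(E_{m,n}, 2, 5)` follows from `ord_{T=0} L_5(E_{m,n},T) = 2`**, mod `h85` + Kato only (converse
of `order_eq_two_of_transfer_zywinaCurve`, which needs `hMC` and R*). CONDITIONAL on `h85`, `hkato`.
[cite: Zywina2025, Thm 1.2] [cite: Kato2004Asterisque, Thm. 17.4 (1)(2) (p. 273)] -/
theorem transfer_instance_of_order_eq_two_zywinaCurve [Fact (Nat.Prime 5)] [Fact (Nat.Prime 2)]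
    (h85 : Schneider1985_order_charGenerator) (h : ZywinaAdmissible m n) [(zywinaCurve m n).IsElliptic]
    [(zywinaCurve m n).IsGloballyMinimal] {N : ℕ} [NeZero N] {f : CuspForm (Gamma0 N) 2}
    (hf : IsNewformOf (zywinaCurve m n) f) (hkato : kato_divisibility_allPrimes (zywinaCurve m n) 5 (f := f))
    (heq : (padicLFunction f (unitRoot (zywinaCurve m n) 5 : ℚ_[5])).order = 2) :
    (zywinaCurve m n).shaCorank 2 = 0 → (zywinaCurve m n).shaCorank 5 = 0 := fun _ ↦ by
  rw [← finite_primaryComponent_sha_iff_shaCorank_eq_zero]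
  exact (schneider_and_finite_sha_five_of_order_eq_two_zywinaCurve h85 h hf hkato heq).2

end Summit.BirchSwinnertonDyer.BirchSwinnertonDyer.Theorems.ShaPrimaryTransferZywinaEqualityDoorKato

end
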